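/-
Copyright (c) 2026 the pub-hodgecm-mathlib formalisation cell (harness21).  Prover seat hodgecm-mathlib-A-p19 (g27), 2026-09-02.  Road «S3-tree»∕«S3-ram» (LEAD F0P3a-plan (g12)
T11-41∕T11-52; owner p06 (g15)), row (e2) «P-2-ram», organ «(D2-β)-ram, part N: THE NORM DICTIONARIES OF THE UNRAMIFIED EIGEN-FIELD OVER A TAME-RAMIFIED BASE» — the
discharges of `hη₀n`, `hnE`, `hnK` of ★ p847100 `RationalGoodVectorRamifiedBase` for BOTH torus types, over ★ `UnramifiedQuadraticDictionary` (part L, this seat).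
-/
import Literature.NumberTheory.NumberFields.UnramifiedQuadraticDictionary        -- ★ part L (this seat): (L1′)(L2′)(L3′); brings ★ [T2-L] `toPlace_mem_integer_of_mem_integer`
import Literature.NumberTheory.LocalFields.RamifiedQuadraticNormCriterion         -- ★ B-p10: `RamifiedQuadraticNorm.exists_mul_map_eq_iff_isSquare_residue` (tame-ramified-type involutions)
import Literature.NumberTheory.LocalFields.UnramifiedQuadraticNormAtInertPlace    -- ★ `UnramifiedQuadraticNorm.exists_mul_map_eq_of_isUnit_integer` (unramified-type involutions)
import Literature.NumberTheory.Automorphic.RamifiedPlaceIntegerInvolution         -- ★ `isUnit_integer_of_v_eq_one`, `isUnit_two_integer_of_v_two_eq_one`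
import HarnessLib

/-!
# The norm dictionaries of the unramified quadratic extension `K = F_v(θ)` for the two involutions `s̃` (type A) and `s̃ ∘ ι′` (type B) over a TAME-RAMIFIED base
# involution `s` (Serre, *Local Fields* V §2 Prop. 3, V §3 Cor. 2)

Topic `NumberTheory/NumberFields`; namespace `Literature.NumberTheory.NumberFields`.  THEOREMS ONLY (no definition, no instance, no notation, no named fact, no `sorry`); kernel lane
`--supports stmt-HodgeConjecture-24833`.  Cell `pub/hodgecm-mathlib` (D-0151), crux H413; road «S3-tree», seeding wave «S3-ram», row (e2) «P-2-ram»; organ **«(D2-β)-ram, part N»** (this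
seat): in the frame of ★ `UnramifiedQuadraticDictionary` (`K = E_w = F_v(θ)`, `θ² = ι₁ d`, `d` a non-square unit FIXED by an isometric involution `s` of `F_v`; `s̃` over `s` with `s̃θ = θ`,
`ι′` over `id` with `ι′θ = −θ`), and for a base involution `s` of TAME-RAMIFIED type — RESIDUALLY TRIVIAL (`|s x − x| < 1` on `𝒪`), `|2| = 1` — the norm dictionaries consumed by
★ p847100 `exists_rational_good_iff_exists_norm_ramifiedBase` (`hη₀n`, `hnE`, `hnK`) for the CM involution of torus type A (`σ_K := s̃`, residually trivial: `K ∕ K^{s̃}` tame-RAMIFIED)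
and of type B (`σ_K := s̃ ∘ ι′`, residually the Frobenius: `K ∕ K^{s̃ι′}` UNRAMIFIED), with `η₀ := ι₁ d` (in the application `F_v = L_w`, `s = σ_w`, `d = η₀ ∈ L⁺_v` the non-square-residue
constant of ★ `RamifiedPlaceUnitNorms`).  HONEST LABEL: HC_CM is proved only modulo the 2 remaining named inputs (hLiu418 24832, h413 24833) until rung 0 closes; local algebra, count-neutral.

* §1 `valued_sub_lt_one_iff_mem_maximalIdeal` (bridge), `map_sub_self_lt_one_of_typeA` (`s̃` is residually trivial on `𝒪[K]`), `isUnit_map_comp_sub_theta` (`(s̃ι′)θ − θ = −2θ` is a unit).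
* §2 `hη₀n`: **`theta_mul_map_theta_eq_toPlace`** (type A: `θ·s̃θ = ι₁ d`), **`exists_mul_map_comp_eq_toPlace`** (type B: `ι₁ d` is an `s̃ι′`-norm, ★ unramified surjectivity).
* §3 `hnE`: **`exists_rational_norm_mul_eq_one_or_eq_toPlace`** — transport of the base dichotomy «`f ∈ F_v^×` `s`-fixed ⇒ `∃ z, z·sz·f ∈ {1, d}`» (hypothesis `hnormF`; at the CM place it is
  ★ `RamifiedPlaceUnitNorms` (U3) + the anti-fixed uniformiser) along `ι₁`, for ANY `σ_K` over `s` (`σ_K ∘ ι₁ = ι₁ ∘ s`).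
* §4 `hnK`: **`exists_mul_map_eq_of_fixed_unit_near_rational_typeA`** (an `s̃`-fixed unit of `𝒪[K]` congruent to a rational-and-`s̃`-fixed element is an `s̃`-norm: its residue is
  `ā²` or `ā²·d̄ = (āθ̄)²`, a square — hypothesis `hsqF` «every `s`-fixed unit of `F_v` is residually `a²` or `a²d` with `a` `s`-fixed» — then ★ `RamifiedQuadraticNorm` criterion) and
  **`exists_mul_map_comp_eq_of_fixed_unit_typeB`** (every `s̃ι′`-fixed unit is a norm, ★ `UnramifiedQuadraticNorm`).

## References
* [SerreLocalFields1979] J.-P. Serre, *Local Fields*, GTM 67 (1979): Ch. V §2 Prop. 3 and Corollary (unramified: `U = N U`), Ch. V §3 Prop. 5, Cor. 2 (tamely ramified: index two,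
  residue squares), Ch. II §4 Prop. 7 (Hensel).
* [Neukirch1999] J. Neukirch, *Algebraic Number Theory*, Grundlehren 322 (1999): Ch. II §7, Ch. V (1.2).
-/

set_option autoImplicit false

noncomputable section

open NumberField IsDedekindDomain Polynomial
open scoped ValuativeRel
open Literature.NumberTheory.Automorphic Literature.NumberTheory.Automorphic.UnitaryGroup Literature.NumberTheory.LocalFields

namespace Literature.NumberTheory.NumberFields

variable {F : Type} (E : Type) [Field F] [NumberField F] [Field E] [NumberField E] [Algebra F E]
  (v : HeightOneSpectrum (𝓞 F)) (w : PlacesOver E v)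

/-! ## §1 Bridges: `𝔪 = {|·| < 1}`; `s̃` is residually trivial (type A); `(s̃ι′)θ − θ` is a unit (type B) -/

omit [NumberField F] in
/-- `x ∈ 𝔪_w ↔ |x|_w < 1` for `x ∈ 𝒪[E_w]`. [cite: SerreLocalFields1979, Ch. I §1] -/
theorem valued_sub_lt_one_iff_mem_maximalIdeal (x : 𝒪[w.1.adicCompletion E]) :
    x ∈ IsLocalRing.maximalIdeal 𝒪[w.1.adicCompletion E] ↔ Valued.v (x : w.1.adicCompletion E) < 1 := by
  rw [IsLocalRing.mem_maximalIdeal, mem_nonunits_iff, (Valuation.integer.integers (ValuativeRel.valuation (w.1.adicCompletion E))).isUnit_iff_valuation_eq_one,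
    ← v_eq_one_iff_valuation_eq_one]
  have hle : Valued.v (x : w.1.adicCompletion E) ≤ 1 := (v_le_one_iff_mem_integer (x : w.1.adicCompletion E)).2 x.2
  exact ⟨fun h => lt_of_le_of_ne hle h, fun h => h.ne⟩

/-- **`s̃` IS RESIDUALLY TRIVIAL ON `𝒪[K]` (type A)** when `s` is residually trivial on `𝒪[F_v]` and `s̃θ = θ`: in the unramified coordinates `s̃(ι₁p + ι₁qθ) − (ι₁p + ι₁qθ) =
ι₁(sp − p) + ι₁(sq − q)θ` has valuation `max(|sp − p|, |sq − q|) < 1`. [cite: SerreLocalFields1979, Ch. V §3] -/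
theorem map_sub_self_lt_one_of_typeA (s : v.adicCompletion F →+* v.adicCompletion F) (hsres : ∀ x : v.adicCompletion F, Valued.v x ≤ 1 → Valued.v (s x - x) < 1)
    {θ : w.1.adicCompletion E} (hval : ∀ p q : v.adicCompletion F, Valued.v (toPlace v w p + toPlace v w q * θ) = max (Valued.v p) (Valued.v q))
    (hcoord : ∀ z : w.1.adicCompletion E, ∃ pq : v.adicCompletion F × v.adicCompletion F, z = toPlace v w pq.1 + toPlace v w pq.2 * θ)
    (s' : w.1.adicCompletion E →+* w.1.adicCompletion E) (hs' : ∀ x, s' (toPlace v w x) = toPlace v w (s x)) (hs'θ : s' θ = θ)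
    (z : w.1.adicCompletion E) (hz : Valued.v z ≤ 1) : Valued.v (s' z - z) < 1 := by
  obtain ⟨⟨p, q⟩, rfl⟩ := hcoord z
  have hpq : Valued.v p ≤ 1 ∧ Valued.v q ≤ 1 := by
    have h := hz
    rw [hval] at h
    exact ⟨le_trans (le_max_left _ _) h, le_trans (le_max_right _ _) h⟩
  have heq : s' (toPlace v w p + toPlace v w q * θ) - (toPlace v w p + toPlace v w q * θ) = toPlace v w (s p - p) + toPlace v w (s q - q) * θ := by
    rw [map_add, map_mul, hs', hs', hs'θ, map_sub, map_sub]; ring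
  rw [heq, hval]
  exact max_lt (hsres p hpq.1) (hsres q hpq.2)

omit [NumberField F] in
/-- **`(s̃ι′)θ − θ = −2θ` IS A UNIT of `𝒪[K]`** (`|θ| = 1`, `|2| = 1`): the type-B CM involution moves an integer by a unit — `K ∕ K^{s̃ι′}` is UNRAMIFIED. [cite: SerreLocalFields1979, Ch. V §2 Prop. 3] -/
theorem isUnit_map_comp_sub_theta (h2 : Valued.v (2 : w.1.adicCompletion E) = 1) {θ : w.1.adicCompletion E} (hθv : Valued.v θ = 1)
    (s' ι' : w.1.adicCompletion E →+* w.1.adicCompletion E) (hs'θ : s' θ = θ) (hι'θ : ι' θ = -θ)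
    (hσO : ∀ z : 𝒪[w.1.adicCompletion E], (s'.comp ι') z ∈ 𝒪[w.1.adicCompletion E]) :
    ∃ a : 𝒪[w.1.adicCompletion E], IsUnit ((⟨(s'.comp ι') a, hσO a⟩ : 𝒪[w.1.adicCompletion E]) - a) := by
  refine ⟨⟨θ, (v_le_one_iff_mem_integer θ).1 hθv.le⟩, ?_⟩
  have hval : Valued.v ((s'.comp ι') θ - θ) = 1 := by
    rw [RingHom.comp_apply, hι'θ, map_neg, hs'θ, show -θ - θ = -(2 * θ) by ring, Valuation.map_neg, map_mul, h2, hθv, one_mul]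
  exact isUnit_integer_of_v_eq_one w.1 hval

/-! ## §2 `hη₀n`: `ι₁ d` is a norm for both involutions -/

/-- **Type A: `θ · s̃θ = ι₁ d`** (`s̃θ = θ`, `θ² = ι₁ d`) — the constant `η₀ = ι₁ d` is an `s̃`-norm. [cite: SerreLocalFields1979, Ch. V §3 Cor. 2] -/
theorem theta_mul_map_theta_eq_toPlace {θ : w.1.adicCompletion E} {d : v.adicCompletion F} (hθ : θ ^ 2 = toPlace v w d)
    (s' : w.1.adicCompletion E →+* w.1.adicCompletion E) (hs'θ : s' θ = θ) : θ * s' θ = toPlace v w d := by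
  rw [hs'θ, ← pow_two, hθ]

/-- **Type B: `ι₁ d` is an `s̃ι′`-norm** (`s d = d`, so `ι₁ d` is a fixed unit; `s̃ι′` moves `θ` by the unit `−2θ`; ★ `UnramifiedQuadraticNorm.exists_mul_map_eq_of_isUnit_integer`).
[cite: SerreLocalFields1979, Ch. V §2 Prop. 3 and Corollary] -/
theorem exists_mul_map_comp_eq_toPlace (h2 : Valued.v (2 : w.1.adicCompletion E) = 1) {θ : w.1.adicCompletion E} (hθv : Valued.v θ = 1)
    {d : v.adicCompletion F} (hdv : Valued.v (toPlace v w d) = 1)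
    (s : v.adicCompletion F →+* v.adicCompletion F) (hsd : s d = d)
    (s' ι' : w.1.adicCompletion E →+* w.1.adicCompletion E) (hs' : ∀ x, s' (toPlace v w x) = toPlace v w (s x)) (hs'θ : s' θ = θ) (hs's' : ∀ z, s' (s' z) = z)
    (hs'O : ∀ z : 𝒪[w.1.adicCompletion E], s' z ∈ 𝒪[w.1.adicCompletion E])
    (hι'ι : ∀ x, ι' (toPlace v w x) = toPlace v w x) (hι'θ : ι' θ = -θ) (hι'ι' : ∀ z, ι' (ι' z) = z)
    (hι'O : ∀ z : 𝒪[w.1.adicCompletion E], ι' z ∈ 𝒪[w.1.adicCompletion E]) (hcomm : ∀ z, s' (ι' z) = ι' (s' z)) :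
    ∃ e : w.1.adicCompletion E, e * (s'.comp ι') e = toPlace v w d := by
  have hσσ : ∀ z, (s'.comp ι') ((s'.comp ι') z) = z := fun z => by
    rw [RingHom.comp_apply, RingHom.comp_apply, ← hcomm, hs's', hι'ι']
  have hσO : ∀ z : 𝒪[w.1.adicCompletion E], (s'.comp ι') z ∈ 𝒪[w.1.adicCompletion E] := fun z => by
    rw [RingHom.comp_apply]; exact hs'O ⟨ι' z, hι'O z⟩
  have hmove := isUnit_map_comp_sub_theta E v w h2 hθv s' ι' hs'θ hι'θ hσO
  have hu : IsUnit (⟨toPlace v w d, (v_le_one_iff_mem_integer _).1 hdv.le⟩ : 𝒪[w.1.adicCompletion E]) := isUnit_integer_of_v_eq_one w.1 hdv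
  have hσu : (s'.comp ι') (toPlace v w d) = toPlace v w d := by rw [RingHom.comp_apply, hι'ι, hs', hsd]
  obtain ⟨t, ht⟩ := UnramifiedQuadraticNorm.exists_mul_map_eq_of_isUnit_integer (s'.comp ι') hσσ hσO hmove _ hu hσu
  exact ⟨t, ht⟩

/-! ## §3 `hnE`: the base dichotomy transported along `ι₁` -/

/-- **`hnE` — every non-zero RATIONAL (`ι′`-fixed), `σ_K`-fixed `c` has a rational `a` with `a·σ_K a·c ∈ {1, ι₁ d}`**, for ANY `σ_K` over `s` (`σ_K ∘ ι₁ = ι₁ ∘ s`: type A `s̃`, type B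
`s̃ι′`), transported from the base dichotomy `hnormF` «`f ≠ 0`, `s f = f` ⇒ `∃ z, z·sz·f = 1 ∨ z·sz·f = d`» (`F_v^× = N ⊔ d·N` at a tame-ramified `s`; ★ `RamifiedPlaceUnitNorms` (U3) at the CM
place) through `Fix ι′ = ι₁(F_v)` (★ part L `map_eq_self_iff_exists_eq_toPlace`, supplied as `hfix`). [cite: SerreLocalFields1979, Ch. V §3 Cor. 2] -/
theorem exists_rational_norm_mul_eq_one_or_eq_toPlace (s : v.adicCompletion F →+* v.adicCompletion F) {d : v.adicCompletion F}
    (hnormF : ∀ f : v.adicCompletion F, f ≠ 0 → s f = f → ∃ z : v.adicCompletion F, z * s z * f = 1 ∨ z * s z * f = d)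
    (σK ι' : w.1.adicCompletion E →+* w.1.adicCompletion E) (hσKι₁ : ∀ x, σK (toPlace v w x) = toPlace v w (s x)) (hι'ι : ∀ x, ι' (toPlace v w x) = toPlace v w x)
    (hfix : ∀ z : w.1.adicCompletion E, ι' z = z → ∃ x, toPlace v w x = z)
    (c : w.1.adicCompletion E) (hc : c ≠ 0) (hσc : σK c = c) (hιc : ι' c = c) :
    ∃ a : w.1.adicCompletion E, ι' a = a ∧ (a * σK a * c = 1 ∨ a * σK a * c = toPlace v w d) := by
  obtain ⟨f, rfl⟩ := hfix c hιc
  have hf : f ≠ 0 := fun h0 => hc (by rw [h0, map_zero])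
  have hsf : s f = f := (toPlace v w).injective (by rw [← hσKι₁, hσc])
  obtain ⟨z, hz⟩ := hnormF f hf hsf
  refine ⟨toPlace v w z, hι'ι z, ?_⟩
  rw [hσKι₁, ← map_mul, ← map_mul, ← map_one (toPlace v w)]
  rcases hz with h | h
  · exact Or.inl (congrArg (toPlace v w) h)
  · exact Or.inr (congrArg (toPlace v w) h)

/-! ## §4 `hnK`: fixed units of `𝒪[K]` near a rational fixed element are norms -/

/-- **`hnK`, type A** (`σ_K = s̃`, residually trivial): an `s̃`-fixed UNIT `u` of `𝒪[K]` with `|u − c| < 1` for some rational, `s̃`-fixed `c` (so `c = ι₁ g`, `s g = g`, `|g| = 1`) is an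
`s̃`-norm — by `hsqF` the residue of `g` is `ā²` or `ā²·d̄`, so `u ≡ (ι₁a)²` or `u ≡ (ι₁a·θ)²` is residually a SQUARE, and ★ `RamifiedQuadraticNorm.exists_mul_map_eq_iff_isSquare_residue`
applies to the residually trivial `s̃` on the complete `𝒪[K]`. [cite: SerreLocalFields1979, Ch. V §3 Prop. 5, Cor. 2] [cite: SerreLocalFields1979, Ch. II §4 Prop. 7] -/
theorem exists_mul_map_eq_of_fixed_unit_near_rational_typeA (h2 : Valued.v (2 : w.1.adicCompletion E) = 1)
    (s : v.adicCompletion F →+* v.adicCompletion F) (hsres : ∀ x : v.adicCompletion F, Valued.v x ≤ 1 → Valued.v (s x - x) < 1)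
    {d : v.adicCompletion F}
    (hsqF : ∀ g : v.adicCompletion F, Valued.v g = 1 → s g = g →
      ∃ a : v.adicCompletion F, Valued.v a ≤ 1 ∧ (Valued.v (g - a ^ 2) < 1 ∨ Valued.v (g - a ^ 2 * d) < 1))
    {θ : w.1.adicCompletion E} (hθ : θ ^ 2 = toPlace v w d) (hθv : Valued.v θ = 1)
    (hval : ∀ p q : v.adicCompletion F, Valued.v (toPlace v w p + toPlace v w q * θ) = max (Valued.v p) (Valued.v q))
    (hcoord : ∀ z : w.1.adicCompletion E, ∃ pq : v.adicCompletion F × v.adicCompletion F, z = toPlace v w pq.1 + toPlace v w pq.2 * θ)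
    (s' ι' : w.1.adicCompletion E →+* w.1.adicCompletion E) (hs' : ∀ x, s' (toPlace v w x) = toPlace v w (s x)) (hs'θ : s' θ = θ) (hs's' : ∀ z, s' (s' z) = z)
    (hs'O : ∀ z : 𝒪[w.1.adicCompletion E], s' z ∈ 𝒪[w.1.adicCompletion E])
    (hfix : ∀ z : w.1.adicCompletion E, ι' z = z → ∃ x, toPlace v w x = z)
    (u : 𝒪[w.1.adicCompletion E]) (hu : Valued.v (u : w.1.adicCompletion E) = 1) (hsu : s' u = u)
    (hnear : ∃ c : w.1.adicCompletion E, s' c = c ∧ ι' c = c ∧ Valued.v ((u : w.1.adicCompletion E) - c) < 1) :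
    ∃ e : w.1.adicCompletion E, e * s' e = u := by
  -- the involution of `𝒪[K]`, `K = E_w`, and its residual triviality
  set σO : 𝒪[w.1.adicCompletion E] →+* 𝒪[w.1.adicCompletion E] :=
    (s'.comp (𝒪[w.1.adicCompletion E]).subtype).codRestrict (𝒪[w.1.adicCompletion E]) fun x => hs'O x with hσOdef
  have hσσ : ∀ x, σO (σO x) = x := fun x => Subtype.ext (hs's' x)
  have hres : ∀ x : 𝒪[w.1.adicCompletion E], σO x - x ∈ IsLocalRing.maximalIdeal 𝒪[w.1.adicCompletion E] := fun x => by
    rw [valued_sub_lt_one_iff_mem_maximalIdeal]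
    exact map_sub_self_lt_one_of_typeA E v w s hsres hval hcoord s' hs' hs'θ x ((v_le_one_iff_mem_integer (x : w.1.adicCompletion E)).2 x.2)
  have h2O : IsUnit (2 : 𝒪[w.1.adicCompletion E]) := isUnit_two_integer_of_v_two_eq_one w.1 h2
  have huO : IsUnit u := by
    have h := isUnit_integer_of_v_eq_one w.1 hu
    exact h
  have hσu : σO u = u := Subtype.ext hsu
  -- the residue of `u` is a square: `u ≡ c = ι₁ g ≡ (ι₁ a)²` or `(ι₁ a θ)²`
  obtain ⟨c, hsc, hιc, huc⟩ := hnear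
  obtain ⟨g, rfl⟩ := hfix c hιc
  have hsg : s g = g := (toPlace v w).injective (by rw [← hs', hsc])
  have hι₁v : ∀ x, Valued.v (toPlace v w x) = Valued.v x := fun x => by
    have h := hval x 0
    rwa [map_zero, zero_mul, add_zero, map_zero, max_eq_left zero_le] at h
  have hg1 : Valued.v g = 1 := by
    rw [← hι₁v]
    have h' : toPlace v w g = (u : w.1.adicCompletion E) + -((u : w.1.adicCompletion E) - toPlace v w g) := by ring
    have hlt : Valued.v (-((u : w.1.adicCompletion E) - toPlace v w g)) < Valued.v (u : w.1.adicCompletion E) := by rw [Valuation.map_neg, hu]; exact huc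
    rw [h', Valuation.map_add_eq_of_lt_left _ hlt, hu]
  obtain ⟨a, ha1, hga⟩ := hsqF g hg1 hsg
  -- a square root `t` of the residue class of `u`
  have hsq : ∃ t : 𝒪[w.1.adicCompletion E], Valued.v ((u : w.1.adicCompletion E) - (t : w.1.adicCompletion E) ^ 2) < 1 := by
    rcases hga with h | h
    · refine ⟨⟨toPlace v w a, (v_le_one_iff_mem_integer _).1 (by rw [hι₁v]; exact ha1)⟩, ?_⟩
      have heq : (u : w.1.adicCompletion E) - (toPlace v w a) ^ 2 = ((u : w.1.adicCompletion E) - toPlace v w g) + toPlace v w (g - a ^ 2) := by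
        rw [map_sub, map_pow]; ring
      rw [heq]
      refine lt_of_le_of_lt (Valuation.map_add _ _ _) (max_lt huc ?_)
      rw [hι₁v]; exact h
    · refine ⟨⟨toPlace v w a * θ, mul_mem ((v_le_one_iff_mem_integer _).1 (by rw [hι₁v]; exact ha1)) ((v_le_one_iff_mem_integer θ).1 hθv.le)⟩, ?_⟩
      have heq : (u : w.1.adicCompletion E) - (toPlace v w a * θ) ^ 2 = ((u : w.1.adicCompletion E) - toPlace v w g) + toPlace v w (g - a ^ 2 * d) := by
        rw [mul_pow, hθ, map_sub, map_mul, map_pow]; ring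
      rw [heq]
      refine lt_of_le_of_lt (Valuation.map_add _ _ _) (max_lt huc ?_)
      rw [hι₁v]; exact h
  obtain ⟨t, ht⟩ := hsq
  have hres_sq : IsSquare (IsLocalRing.residue 𝒪[w.1.adicCompletion E] u) := by
    refine ⟨IsLocalRing.residue 𝒪[w.1.adicCompletion E] t, ?_⟩
    rw [← map_mul, ← sub_eq_zero, ← map_sub, IsLocalRing.residue_eq_zero_iff, valued_sub_lt_one_iff_mem_maximalIdeal]
    have hcoe : (((u - t * t : 𝒪[w.1.adicCompletion E])) : w.1.adicCompletion E) = (u : w.1.adicCompletion E) - (t : w.1.adicCompletion E) ^ 2 := by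
      push_cast; ring
    rw [hcoe]
    exact ht
  obtain ⟨e, he⟩ := (RamifiedQuadraticNorm.exists_mul_map_eq_iff_isSquare_residue σO hσσ hres h2O huO hσu).2 hres_sq
  exact ⟨e, congrArg Subtype.val he⟩

omit [NumberField F] in
/-- **`hnK`, type B** (`σ_K = s̃ι′`, residually the Frobenius): EVERY `s̃ι′`-fixed unit of `𝒪[K]` is an `s̃ι′`-norm (★ `UnramifiedQuadraticNorm.exists_mul_map_eq_of_isUnit_integer`, the
involution moving `θ` by the unit `−2θ`). [cite: SerreLocalFields1979, Ch. V §2 Prop. 3 and Corollary] -/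
theorem exists_mul_map_comp_eq_of_fixed_unit_typeB (h2 : Valued.v (2 : w.1.adicCompletion E) = 1) {θ : w.1.adicCompletion E} (hθv : Valued.v θ = 1)
    (s' ι' : w.1.adicCompletion E →+* w.1.adicCompletion E) (hs'θ : s' θ = θ) (hs's' : ∀ z, s' (s' z) = z)
    (hs'O : ∀ z : 𝒪[w.1.adicCompletion E], s' z ∈ 𝒪[w.1.adicCompletion E])
    (hι'θ : ι' θ = -θ) (hι'ι' : ∀ z, ι' (ι' z) = z) (hι'O : ∀ z : 𝒪[w.1.adicCompletion E], ι' z ∈ 𝒪[w.1.adicCompletion E])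
    (hcomm : ∀ z, s' (ι' z) = ι' (s' z))
    (u : 𝒪[w.1.adicCompletion E]) (hu : Valued.v (u : w.1.adicCompletion E) = 1) (hσu : (s'.comp ι') u = u) :
    ∃ e : w.1.adicCompletion E, e * (s'.comp ι') e = u := by
  have hσσ : ∀ z, (s'.comp ι') ((s'.comp ι') z) = z := fun z => by
    rw [RingHom.comp_apply, RingHom.comp_apply, ← hcomm, hs's', hι'ι']
  have hσO : ∀ z : 𝒪[w.1.adicCompletion E], (s'.comp ι') z ∈ 𝒪[w.1.adicCompletion E] := fun z => by
    rw [RingHom.comp_apply]; exact hs'O ⟨ι' z, hι'O z⟩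
  have hmove := isUnit_map_comp_sub_theta E v w h2 hθv s' ι' hs'θ hι'θ hσO
  obtain ⟨t, ht⟩ := UnramifiedQuadraticNorm.exists_mul_map_eq_of_isUnit_integer (s'.comp ι') hσσ hσO hmove u (isUnit_integer_of_v_eq_one w.1 hu) hσu
  exact ⟨t, ht⟩

end Literature.NumberTheory.NumberFields

end
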